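import Summits.KontsevichZagierPeriods.KontsevichZagierPeriods.Theses.LiftingCriteria
import Literature.NumberTheory.Transcendental.KZDilationBakerSectorComplex

/-!
# `DilationLiftAtOne` holds on the complex Baker sector (crux stmt-KontsevichZagierPeriods-3571,
route LiftingCriteria, line `registered`, registered stub `stub_bakerSectorComplex`)

**Theorem (unconditional).** For `ρ` Nash on `(a,b) ⊇ [0,1]` and real algebraic pole data
`(p_k, q_k)` (inverse poles `p_k + iq_k`, avoiding `[a,b]`: `0 < 1 − p_k x ∨ q_k x ≠ 0` on `(a,b)`) and
residues `γ_k + iδ_k`, the general one-variable Nash-exact-plus-simple-poles integrand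
`g = ρ' + Σ_k (γ_k(−p_k + (p_k²+q_k²)x) + δ_k q_k)/((1 − p_k x)² + (q_k x)²)` (REAL OR COMPLEX poles —
every `P/Q ∈ (ℚ̄ ∩ ℝ)(x)` regular on `[a,b]` has this shape after partial fractions, higher-order
poles going into `ρ`) with vanishing cube period has its dilation function in `(ϖ − 1)·D'` with
ONE Nash kernel near `[0,1] × [0,1]` — the conclusion of the glue stub / of the crux for this `g`.
The whole proof is the Literature theorem
`Literature.NumberTheory.Transcendental.KZ.dilationBakerSectorComplex_lift` (files
`KZDilationBakerSectorComplex{Prep,Relations,Lifts}.lean`, `KZDilationArctanSector.lean`,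
`KZDilationArgHalving.lean`, `KZDilationLogGeneratorsNash.lean`, `BakerRelationDecomposition.lean`):
Baker's theorem in complex form (`baker_holds`, sorry-free) decomposes the polar part along
rational exact relations; real parts lift through the logarithmic sector, imaginary parts
(arguments) through the arctangent sector after explicit angle halving. It contains the route's
day-one test `g = 1/(1+x²) − 2x/(1+x⁴)` (`arctan ϖ − arctan ϖ²`) and supersedes the real sector
`stub_bakerSectorReal` (`q = 0`).
-/

noncomputable section

open scoped BigOperators

namespace Summit.KontsevichZagierPeriods.LiftingCriteria.DilationLiftAtOne

/-- **Stub `stub_bakerSectorComplex` of the registered skeleton of crux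
stmt-KontsevichZagierPeriods-3571 (line `registered`, reshaped by lead c2): the complex Baker sector
of the glue holds unconditionally.** Verbatim the registered signature; proof =
`Literature.NumberTheory.Transcendental.KZ.dilationBakerSectorComplex_lift`.
[cite: Baker1975, Theorem 2.1] -/
theorem stub_bakerSectorComplex :
    ∀ (a b : ℝ), a < 0 → 1 < b → ∀ (ρ : ℝ → ℝ), Literature.NumberTheory.Transcendental.IsSemialgebraicFunOn ℚ {t : Fin 1 → ℝ | t 0 ∈ Set.Ioo a b} (fun t => ρ (t 0)) → (∀ x ∈ Set.Ioo a b, AnalyticAt ℝ ρ x) → ∀ (A : ℕ) (p q γ δ : Fin A → ℝ), (∀ k, IsAlgebraic ℚ (p k)) → (∀ k, IsAlgebraic ℚ (q k)) → (∀ k, IsAlgebraic ℚ (γ k)) → (∀ k, IsAlgebraic ℚ (δ k)) → (∀ k, ∀ x ∈ Set.Ioo a b, 0 < 1 - p k * x ∨ q k * x ≠ 0) → (∫ z in Set.pi Set.univ (fun _ : Fin 1 => Set.Icc (0:ℝ) 1), (deriv ρ (((1:ℝ) • z) 0) + ∑ k, (γ k * (-p k + (p k ^ 2 + q k ^ 2)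 * (((1:ℝ) • z) 0)) + δ k * q k) / ((1 - p k * (((1:ℝ) • z) 0)) ^ 2 + (q k * (((1:ℝ) • z) 0)) ^ 2))) = 0 → ∃ (K : (Fin 2 → ℝ) → ℝ) (V : Set (Fin 2 → ℝ)), IsOpen V ∧ (∀ ϖ ∈ Set.Icc (0:ℝ) 1, ∀ x ∈ Set.pi Set.univ (fun _ : Fin 1 => Set.Icc (0:ℝ) 1), Matrix.vecCons ϖ x ∈ V) ∧ Literature.NumberTheory.Transcendental.IsSemialgebraicFunOn ℚ V K ∧ AnalyticOnNhd ℝ K V ∧ ∀ ϖ ∈ Set.Icc (0:ℝ) 1, (∫ z in Set.pi Set.univ (fun _ : Fin 1 => Set.Icc (0:ℝ) 1), (deriv ρ ((ϖ • z) 0) + ∑ k, (γ k * (-p k + (p k ^ 2 + q k ^ 2) * ((ϖ • z) 0)) + δ k * q k) / ((1 - p k * ((ϖ • z) 0)) ^ 2 + (q k * ((ϖ • z) 0)) ^ 2))) = (ϖ - 1) * ∫ y in Set.pi Set.univ (fun _ : Fin 1 => Set.Icc (0:ℝ) 1), K (Matrix.vecCons ϖ (ϖ • y)) :=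
  fun _ _ ha hb _ hρs hρa _ _ _ _ _ hp hq hγ hδ hslit hsum =>
    Literature.NumberTheory.Transcendental.KZ.dilationBakerSectorComplex_lift ha hb hρs hρa hp hq hγ hδ
      hslit hsum

end Summit.KontsevichZagierPeriods.LiftingCriteria.DilationLiftAtOne
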